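import Summits.PneNP.PneNP.Theorems.KarlinRubinMonotoneBlindDnfWitness

/-!
# Route KarlinRubin, crux `MonotoneBlind` (stmt-PneNP-18027): depth 3 — witness split and disjoint inside parts

Depth-3 line (seat write-up `MonotoneBlind_depth3_theorem.md` on the item): `f = ⋁_{i<m} g_i` with `g_i` the monotone
CNF of the clause family `𝓒 i` (`g_i x = ∀ S ∈ 𝓒 i, ∃ e ∈ S, x e`). A *transversal* of `𝓒 i` is a slot set meeting every
clause. For a planted set `A`, a slot is *inside* `A` if both endpoints lie in `A`.

* `depth3_light_count` — the witness lemma for ORs of CNFs (from `dnf_witness_count` applied to the family of light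
  transversals): inputs whose planted graph contains a transversal of some `𝓒 i` with `≤ t` slots inside `A` are at
  most `2^t` times the inputs accepted by `f`;
* `depth3_split_count` — `#{x : f (plant A x)} ≤ 2^t #{x : f x} + Σ_i #{x : H_t(𝓒 i, A, x)}`, where `H_t` says
  "`g_i (plant A x) = 1` and every transversal inside `plant A x` has `> t` slots inside `A`";
* `depth3_disjoint_parts` — on `H_t`, if every clause *needing rescue* (no on-slot of `x` outside `A`) has `≤ r` slots
  inside `A`, then for every `j` with `j r ≤ t + r` there are `j` clauses needing rescue whose inside-`A` parts are
  nonempty and pairwise disjoint (greedy: a maximal such family would give a transversal with `≤ t` inside slots).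

All `--supports stmt-PneNP-18027`; no definitions.
-/

set_option linter.dupNamespace false -- `Summit.PneNP.PneNP.…`: summit = sub-problem (D-0017)

namespace Summit.PneNP.PneNP.Theorems

open Finset
open Literature.Computability.Complexity
open Literature.Probability.RandomGraphs.PlantedClique

variable {n : ℕ}

/-! ### The witness lemma for ORs of CNFs -/

open Classical in
/-- **Witness lemma for ORs of CNFs (counting form).** For a planted set `A` and threshold `t`: the inputs `x` such
that `plant A x` contains a transversal of some `𝓒 i` having at most `t` slots inside `A` number at most `2^t` times
the inputs satisfying some CNF `𝓒 i` themselves (`dnf_witness_count` for the family of light transversals). [folklore] -/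
theorem depth3_light_count (A : Finset (Fin n)) {m : ℕ}
    (𝓒 : Fin m → Finset (Finset (⊤ : SimpleGraph (Fin n)).edgeSet)) (t : ℕ) :
    #(univ.filter fun x : EdgeVec n => ∃ i, ∃ T : Finset (⊤ : SimpleGraph (Fin n)).edgeSet,
        (∀ S ∈ 𝓒 i, ∃ e ∈ S, e ∈ T) ∧ (∀ e ∈ T, plant A x e = true) ∧
          #(T.filter fun e : (⊤ : SimpleGraph (Fin n)).edgeSet => ∀ v ∈ (e : Sym2 (Fin n)), v ∈ A) ≤ t) ≤
      2 ^ t * #(univ.filter fun x : EdgeVec n => ∃ i, ∀ S ∈ 𝓒 i, ∃ e ∈ S, x e = true) := by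
  classical
  set 𝓛 : Finset (Finset (⊤ : SimpleGraph (Fin n)).edgeSet) := univ.filter fun T =>
      (∃ i, ∀ S ∈ 𝓒 i, ∃ e ∈ S, e ∈ T) ∧
        #(T.filter fun e : (⊤ : SimpleGraph (Fin n)).edgeSet => ∀ v ∈ (e : Sym2 (Fin n)), v ∈ A) ≤ t with h𝓛
  have hlight := dnf_witness_count A 𝓛 t (fun T hT => by rw [h𝓛] at hT; exact (mem_filter.1 hT).2.2)
  calc #(univ.filter fun x : EdgeVec n => ∃ i, ∃ T : Finset (⊤ : SimpleGraph (Fin n)).edgeSet,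
          (∀ S ∈ 𝓒 i, ∃ e ∈ S, e ∈ T) ∧ (∀ e ∈ T, plant A x e = true) ∧
            #(T.filter fun e : (⊤ : SimpleGraph (Fin n)).edgeSet => ∀ v ∈ (e : Sym2 (Fin n)), v ∈ A) ≤ t)
      ≤ #(univ.filter fun x : EdgeVec n => ∃ T ∈ 𝓛, ∀ e ∈ T, plant A x e = true) := by
        refine card_le_card fun x hx => ?_
        simp only [mem_filter, mem_univ, true_and] at hx ⊢
        obtain ⟨i, T, hT, hTy, hTt⟩ := hx
        refine ⟨T, ?_, hTy⟩
        rw [h𝓛]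
        exact mem_filter.2 ⟨mem_univ _, ⟨i, hT⟩, hTt⟩
    _ ≤ 2 ^ t * #(univ.filter fun x : EdgeVec n => ∃ T ∈ 𝓛, ∀ e ∈ T, x e = true) := hlight
    _ ≤ 2 ^ t * #(univ.filter fun x : EdgeVec n => ∃ i, ∀ S ∈ 𝓒 i, ∃ e ∈ S, x e = true) := by
        refine Nat.mul_le_mul_left _ (card_le_card fun x hx => ?_)
        simp only [mem_filter, mem_univ, true_and] at hx ⊢
        obtain ⟨T, hT, hTx⟩ := hx
        rw [h𝓛] at hT
        obtain ⟨⟨i, hi⟩, -⟩ := (mem_filter.1 hT).2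
        refine ⟨i, fun S hS => ?_⟩
        obtain ⟨e, he, heT⟩ := hi S hS
        exact ⟨e, he, hTx e heT⟩

/-! ### The split: light witnesses versus `H_t` -/

open Classical in
/-- **The depth-3 split (counting form).** For every planted set `A` and threshold `t`: the inputs whose planted
graph satisfies `f = ⋁ᵢ g_i` are at most `2^t` times the inputs satisfying `f`, plus, for each `i`, the inputs in
`H_t(𝓒 i, A, ·)`: `g_i (plant A x) = 1` and every transversal of `𝓒 i` inside `plant A x` has more than `t` slots inside
`A` (an accepted planted input that is not light is in some `H_t`). [folklore] -/
theorem depth3_split_count (A : Finset (Fin n)) {m : ℕ}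
    (𝓒 : Fin m → Finset (Finset (⊤ : SimpleGraph (Fin n)).edgeSet)) (t : ℕ) :
    #(univ.filter fun x : EdgeVec n => ∃ i, ∀ S ∈ 𝓒 i, ∃ e ∈ S, plant A x e = true) ≤
      2 ^ t * #(univ.filter fun x : EdgeVec n => ∃ i, ∀ S ∈ 𝓒 i, ∃ e ∈ S, x e = true) +
        ∑ i, #(univ.filter fun x : EdgeVec n =>
          (∀ S ∈ 𝓒 i, ∃ e ∈ S, plant A x e = true) ∧
            ∀ T : Finset (⊤ : SimpleGraph (Fin n)).edgeSet, (∀ S ∈ 𝓒 i, ∃ e ∈ S, e ∈ T) →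
              (∀ e ∈ T, plant A x e = true) →
                t < #(T.filter fun e : (⊤ : SimpleGraph (Fin n)).edgeSet => ∀ v ∈ (e : Sym2 (Fin n)), v ∈ A)) := by
  classical
  set Light := univ.filter fun x : EdgeVec n => ∃ i, ∃ T : Finset (⊤ : SimpleGraph (Fin n)).edgeSet,
      (∀ S ∈ 𝓒 i, ∃ e ∈ S, e ∈ T) ∧ (∀ e ∈ T, plant A x e = true) ∧
        #(T.filter fun e : (⊤ : SimpleGraph (Fin n)).edgeSet => ∀ v ∈ (e : Sym2 (Fin n)), v ∈ A) ≤ t with hLight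
  set H : Fin m → Finset (EdgeVec n) := fun i => univ.filter fun x : EdgeVec n =>
      (∀ S ∈ 𝓒 i, ∃ e ∈ S, plant A x e = true) ∧
        ∀ T : Finset (⊤ : SimpleGraph (Fin n)).edgeSet, (∀ S ∈ 𝓒 i, ∃ e ∈ S, e ∈ T) →
          (∀ e ∈ T, plant A x e = true) →
            t < #(T.filter fun e : (⊤ : SimpleGraph (Fin n)).edgeSet => ∀ v ∈ (e : Sym2 (Fin n)), v ∈ A) with hH
  have hcover : (univ.filter fun x : EdgeVec n => ∃ i, ∀ S ∈ 𝓒 i, ∃ e ∈ S, plant A x e = true) ⊆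
      Light ∪ univ.biUnion H := by
    intro x hx
    simp only [mem_filter, mem_univ, true_and] at hx
    obtain ⟨i, hi⟩ := hx
    rw [mem_union]
    by_cases hl : x ∈ Light
    · exact Or.inl hl
    · refine Or.inr (mem_biUnion.2 ⟨i, mem_univ _, ?_⟩)
      rw [hH]
      simp only [mem_filter, mem_univ, true_and]
      refine ⟨hi, fun T hT hTy => ?_⟩
      by_contra hle
      refine hl ?_
      rw [hLight]
      simp only [mem_filter, mem_univ, true_and]
      exact ⟨i, T, hT, hTy, not_lt.1 hle⟩
  calc #(univ.filter fun x : EdgeVec n => ∃ i, ∀ S ∈ 𝓒 i, ∃ e ∈ S, plant A x e = true)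
      ≤ #(Light ∪ univ.biUnion H) := card_le_card hcover
    _ ≤ #Light + #(univ.biUnion H) := card_union_le _ _
    _ ≤ 2 ^ t * #(univ.filter fun x : EdgeVec n => ∃ i, ∀ S ∈ 𝓒 i, ∃ e ∈ S, x e = true) + ∑ i, #(H i) :=
        add_le_add (depth3_light_count A 𝓒 t) card_biUnion_le

/-! ### Disjoint inside parts on `H_t` -/

/-- **Disjoint inside parts.** Fix `A`, a clause family `𝓒`, an input `x` in `H_t(𝓒, A, ·)` and a bound `r` on the
number of slots inside `A` of every clause needing rescue (a clause *needs rescue* if it has no on-slot of `x`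
outside `A`). Then for every `j` with `j·r ≤ t + r` there are `j` distinct clauses needing rescue whose inside-`A`
parts are nonempty and pairwise disjoint. Induction on `j`: the union `U` of the parts found so far has `≤ t` slots;
if every clause needing rescue met `U`, the on-slots of `plant A x` outside `A` together with `U` would form a
transversal with `≤ t` slots inside `A`, contradicting `H_t`; a clause needing rescue that misses `U` has a nonempty
inside part (its on-slot in `plant A x` is inside `A`) disjoint from `U`. [folklore] -/
theorem depth3_disjoint_parts (A : Finset (Fin n)) (𝓒 : Finset (Finset (⊤ : SimpleGraph (Fin n)).edgeSet))
    (x : EdgeVec n) (t r : ℕ)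
    (hsat : ∀ S ∈ 𝓒, ∃ e ∈ S, plant A x e = true)
    (hheavy : ∀ T : Finset (⊤ : SimpleGraph (Fin n)).edgeSet, (∀ S ∈ 𝓒, ∃ e ∈ S, e ∈ T) →
      (∀ e ∈ T, plant A x e = true) →
        t < #(T.filter fun e : (⊤ : SimpleGraph (Fin n)).edgeSet => ∀ v ∈ (e : Sym2 (Fin n)), v ∈ A))
    (hG : ∀ S ∈ 𝓒, (∀ e ∈ S, (¬ ∀ v ∈ (e : Sym2 (Fin n)), v ∈ A) → x e = false) →
      #(S.filter fun e : (⊤ : SimpleGraph (Fin n)).edgeSet => ∀ v ∈ (e : Sym2 (Fin n)), v ∈ A) ≤ r) :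
    ∀ j, j * r ≤ t + r → ∃ 𝓕 : Finset (Finset (⊤ : SimpleGraph (Fin n)).edgeSet), 𝓕 ⊆ 𝓒 ∧ #𝓕 = j ∧
      (∀ S ∈ 𝓕, ∀ e ∈ S, (¬ ∀ v ∈ (e : Sym2 (Fin n)), v ∈ A) → x e = false) ∧
      (∀ S ∈ 𝓕, (S.filter fun e : (⊤ : SimpleGraph (Fin n)).edgeSet => ∀ v ∈ (e : Sym2 (Fin n)), v ∈ A).Nonempty) ∧
      (∀ S ∈ 𝓕, ∀ S' ∈ 𝓕, S ≠ S' →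
        Disjoint (S.filter fun e : (⊤ : SimpleGraph (Fin n)).edgeSet => ∀ v ∈ (e : Sym2 (Fin n)), v ∈ A)
          (S'.filter fun e : (⊤ : SimpleGraph (Fin n)).edgeSet => ∀ v ∈ (e : Sym2 (Fin n)), v ∈ A)) := by
  classical
  -- shorthand for the inside part of a clause
  set ins : Finset (⊤ : SimpleGraph (Fin n)).edgeSet → Finset (⊤ : SimpleGraph (Fin n)).edgeSet :=
    fun S => S.filter fun e : (⊤ : SimpleGraph (Fin n)).edgeSet => ∀ v ∈ (e : Sym2 (Fin n)), v ∈ A with hins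
  -- a clause needing rescue has a nonempty inside part
  have hne : ∀ S ∈ 𝓒, (∀ e ∈ S, (¬ ∀ v ∈ (e : Sym2 (Fin n)), v ∈ A) → x e = false) → (ins S).Nonempty := by
    intro S hS hresc
    obtain ⟨e, he, hey⟩ := hsat S hS
    by_cases heA : ∀ v ∈ (e : Sym2 (Fin n)), v ∈ A
    · exact ⟨e, by rw [hins]; exact mem_filter.2 ⟨he, heA⟩⟩
    · exfalso
      rw [plant_apply_of_not_inside A x e heA, hresc e he heA] at hey
      exact Bool.false_ne_true hey
  intro j
  induction j with
  | zero =>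
    intro _
    exact ⟨∅, empty_subset _, card_empty, by simp, by simp, by simp⟩
  | succ j ih =>
    intro hj
    have hjr : j * r ≤ t := by
      have : j * r + r ≤ t + r := by simpa [Nat.succ_mul] using hj
      omega
    obtain ⟨𝓕, h𝓕𝓒, hcard, hresc, hnonempty, hdisj⟩ := ih (by omega)
    -- the union of the inside parts found so far
    set U := 𝓕.biUnion ins with hU
    have hUins : ∀ e ∈ U, ∀ v ∈ (e : Sym2 (Fin n)), v ∈ A := by
      intro e he
      rw [hU, mem_biUnion] at he
      obtain ⟨S, -, heS⟩ := he
      rw [hins] at heS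
      exact (mem_filter.1 heS).2
    have hUcard : #U ≤ t := by
      calc #U ≤ ∑ S ∈ 𝓕, #(ins S) := card_biUnion_le
        _ ≤ ∑ _S ∈ 𝓕, r := sum_le_sum fun S hS => hG S (h𝓕𝓒 hS) (hresc S hS)
        _ = j * r := by rw [sum_const, smul_eq_mul, hcard]
        _ ≤ t := hjr
    -- some clause needing rescue misses `U`
    have hmiss : ∃ S ∈ 𝓒, (∀ e ∈ S, (¬ ∀ v ∈ (e : Sym2 (Fin n)), v ∈ A) → x e = false) ∧ ∀ e ∈ S, e ∉ U := by
      by_contra hall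
      have hall' : ∀ S ∈ 𝓒, (∀ e ∈ S, (¬ ∀ v ∈ (e : Sym2 (Fin n)), v ∈ A) → x e = false) →
          ∃ e ∈ S, e ∈ U := by
        intro S hS hr
        by_contra h
        exact hall ⟨S, hS, hr, fun e he heU => h ⟨e, he, heU⟩⟩
      set T := univ.filter fun e : (⊤ : SimpleGraph (Fin n)).edgeSet =>
        plant A x e = true ∧ ((¬ ∀ v ∈ (e : Sym2 (Fin n)), v ∈ A) ∨ e ∈ U) with hT
      have hTtrans : ∀ S ∈ 𝓒, ∃ e ∈ S, e ∈ T := by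
        intro S hS
        by_cases hr : ∀ e ∈ S, (¬ ∀ v ∈ (e : Sym2 (Fin n)), v ∈ A) → x e = false
        · obtain ⟨e, heS, heU⟩ := hall' S hS hr
          refine ⟨e, heS, ?_⟩
          rw [hT, mem_filter]
          exact ⟨mem_univ _, plant_apply_of_inside A x e (hUins e heU), Or.inr heU⟩
        · have hr' : ∃ e ∈ S, (¬ ∀ v ∈ (e : Sym2 (Fin n)), v ∈ A) ∧ x e = true := by
            by_contra h
            refine hr fun e he heA => ?_
            cases hxe : x e
            · rfl
            · exact absurd ⟨e, he, heA, hxe⟩ h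
          obtain ⟨e, heS, heA, hxe⟩ := hr'
          refine ⟨e, heS, ?_⟩
          rw [hT, mem_filter]
          refine ⟨mem_univ _, ?_, Or.inl heA⟩
          rw [plant_apply_of_not_inside A x e heA]
          exact hxe
      have hTon : ∀ e ∈ T, plant A x e = true := fun e he => by
        rw [hT] at he; exact (mem_filter.1 he).2.1
      have hTin : (T.filter fun e : (⊤ : SimpleGraph (Fin n)).edgeSet => ∀ v ∈ (e : Sym2 (Fin n)), v ∈ A) ⊆ U := by
        intro e he
        rw [mem_filter, hT, mem_filter] at he
        rcases he.1.2.2 with h | h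
        · exact absurd he.2 h
        · exact h
      have hlt := hheavy T hTtrans hTon
      exact absurd ((card_le_card hTin).trans hUcard) (not_le.2 hlt)
    obtain ⟨S₀, hS₀𝓒, hS₀resc, hS₀U⟩ := hmiss
    have hS₀ne : (ins S₀).Nonempty := hne S₀ hS₀𝓒 hS₀resc
    have hS₀notin : S₀ ∉ 𝓕 := by
      intro hmem
      obtain ⟨e, he⟩ := hS₀ne
      have heU : e ∈ U := by rw [hU, mem_biUnion]; exact ⟨S₀, hmem, he⟩
      rw [hins] at he
      exact hS₀U e (mem_filter.1 he).1 heU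
    have hdisj₀ : ∀ S' ∈ 𝓕, Disjoint (ins S₀) (ins S') := by
      intro S' hS'
      rw [Finset.disjoint_left]
      intro e he he'
      have heU : e ∈ U := by rw [hU, mem_biUnion]; exact ⟨S', hS', he'⟩
      rw [hins] at he
      exact hS₀U e (mem_filter.1 he).1 heU
    refine ⟨insert S₀ 𝓕, ?_, ?_, ?_, ?_, ?_⟩
    · exact insert_subset hS₀𝓒 h𝓕𝓒
    · rw [card_insert_of_notMem hS₀notin, hcard]
    · intro S hS
      rcases mem_insert.1 hS with rfl | hS1
      · exact hS₀resc
      · exact hresc S hS1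
    · intro S hS
      rcases mem_insert.1 hS with rfl | hS1
      · exact hS₀ne
      · exact hnonempty S hS1
    · intro S hS S' hS' hne'
      rcases mem_insert.1 hS with rfl | hS1
      · rcases mem_insert.1 hS' with rfl | hS2
        · exact absurd rfl hne'
        · exact hdisj₀ S' hS2
      · rcases mem_insert.1 hS' with rfl | hS2
        · exact (hdisj₀ S hS1).symm
        · exact hdisj S hS1 S' hS2 hne'

/-! ### Registered form -/

open Classical in
/-- **stub_depth3Witness** (registered side result of stmt-PneNP-18027, depth-3 line of seat 0; NOT a stub of the
picked line's composition): the depth-3 split `depth3_split_count` with all parameters explicit. [folklore] -/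
theorem stub_depth3Witness : ∀ (n : ℕ) (A : Finset (Fin n)) (m : ℕ) (𝓒 : Fin m → Finset (Finset ((⊤ : SimpleGraph (Fin n)).edgeSet))) (t : ℕ), (Finset.univ.filter fun x : EdgeVec n => ∃ i, ∀ S ∈ 𝓒 i, ∃ e ∈ S, plant A x e = true).card ≤ 2 ^ t * (Finset.univ.filter fun x : EdgeVec n => ∃ i, ∀ S ∈ 𝓒 i, ∃ e ∈ S, x e = true).card + ∑ i, (Finset.univ.filter fun x : EdgeVec n => (∀ S ∈ 𝓒 i, ∃ e ∈ S, plant A x e = true) ∧ ∀ T : Finset ((⊤ : SimpleGraph (Fin n)).edgeSet), (∀ S ∈ 𝓒 i, ∃ e ∈ S, e ∈ T) → (∀ e ∈ T, plant A x e = true) → t < (T.filter fun e : ((⊤ : SimpleGraph (Fin n)).edgeSet) => ∀ v ∈ (e : Sym2 (Fin n)), v ∈ A).card).card :=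
  fun _ A _ 𝓒 t => depth3_split_count A 𝓒 t

end Summit.PneNP.PneNP.Theorems
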